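import Summits.QuantumAdvantage.QuantumAdvantage.Theorems.OrbitAveragingD

/-! # OrbitAveraging — part 5/5 (mechanical split for landing of `OrbitAveraging`; content verbatim; scopes re-opened with their variables) -/

set_option linter.dupNamespace false
set_option linter.style.longLine false
set_option linter.unusedVariables false
noncomputable section
open scoped Classical

namespace Summit.QuantumAdvantage.QuantumAdvantage.Theorems.OrbitAveraging
open Finset
open Literature.Computability.QuantumComplexity Literature.Computability.QuantumComplexity.RingHLF
open Literature.Computability.MetaComplexity Literature.Computability.MetaComplexity.Smolensky
open Summit.QuantumAdvantage.AdviceFreeQNC0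
open Summit.QuantumAdvantage.QuantumAdvantage.Theorems (flat)
open Summit.QuantumAdvantage.QuantumAdvantage.Theorems.RingPeriodFold (cov covStrat covStrat_mem_lowDeg cov_eq_covStrat)
open Summit.QuantumAdvantage.QuantumAdvantage.Theorems.SpreadBridge (JointStrategy winAllSet sum_card_filter_update
  fibre_decrement decay_le_half)
variable {n : ℕ}

section NormalFormLaw
open Summit.QuantumAdvantage.AdviceFreeQNC0.RingSymmetry (shift rot_mod rot_rot rot_apply rel_rot shift_bijective
  rot_injective shift_shift rot_eq_rot_of_mod_eq card_filter_comp_of_bijective card_filter_shift)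
open Summit.QuantumAdvantage.AdviceFreeQNC0.Symmetrization (pre pre_shift shift_pre)
open Summit.QuantumAdvantage.QuantumAdvantage.Theorems (unflat flat_unflat)
open Summit.QuantumAdvantage.QuantumAdvantage.Theorems.RingLeaderElection3 (ι3 coord3 coord3_mem fireCount3 exists_election3)
open Summit.QuantumAdvantage.QuantumAdvantage.Theorems.RingSymmetrization3 (leader fires_iff_eq_leader election_params)

section Counting
variable {m n : ℕ}

/-- some phase vector does at least average. -/
theorem exists_phase (hn : 0 < n) (e : CubeFn (ZMod 3) n) (W : Finset (Fin m → Fin n → Bool)) :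
    ∃ s : Fin m → Fin n,
      (univ.filter fun X : Fin m → Fin n → Bool => X ∈ goodT (m := m) e ∧ X ∈ W).card ≤
        (univ.filter fun X : Fin m → Fin n → Bool =>
          X ∈ goodT (m := m) e ∧ zT hn e (fun t => (s t).val) X ∈ W).card := by
  haveI : Nonempty (Fin m → Fin n) := ⟨fun _ => ⟨0, hn⟩⟩
  have hne : (univ : Finset (Fin m → Fin n)).Nonempty := univ_nonempty
  have hsum : ∑ _s : Fin m → Fin n, (univ.filter fun X : Fin m → Fin n → Bool => X ∈ goodT (m := m) e ∧ X ∈ W).card ≤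
      ∑ s : Fin m → Fin n, (univ.filter fun X : Fin m → Fin n → Bool =>
          X ∈ goodT (m := m) e ∧ zT hn e (fun t => (s t).val) X ∈ W).card := by
    rw [phase_sum hn e W, sum_const, card_univ, smul_eq_mul]
  obtain ⟨s, _, hs⟩ := Finset.exists_le_of_sum_le hne hsum
  exact ⟨s, hs⟩

/-- tuples with SOME bad ring: `#(¬ all-good) · 2ⁿ ≤ m · #Bad · #tuples`. -/
theorem card_not_goodT_le (e : CubeFn (ZMod 3) n) :
    (univ.filter fun X : Fin m → Fin n → Bool => ¬ X ∈ goodT (m := m) e).card * Fintype.card (Fin n → Bool) ≤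
      m * ((univ.filter fun x : Fin n → Bool => fireCount3 e x ≠ 1).card *
        Fintype.card (Fin m → Fin n → Bool)) := by
  -- one ring at a time
  have hone : ∀ t : Fin m,
      (univ.filter fun X : Fin m → Fin n → Bool => fireCount3 e (X t) ≠ 1).card * Fintype.card (Fin n → Bool) =
        (univ.filter fun x : Fin n → Bool => fireCount3 e x ≠ 1).card * Fintype.card (Fin m → Fin n → Bool) := by
    intro t
    have h := sum_card_filter_update t (fun X : Fin m → Fin n → Bool => fireCount3 e (X t) ≠ 1)
    have h' : ∀ X : Fin m → Fin n → Bool,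
        (univ.filter fun y : Fin n → Bool => fireCount3 e ((Function.update X t y) t) ≠ 1).card =
          (univ.filter fun x : Fin n → Bool => fireCount3 e x ≠ 1).card := by
      intro X
      simp only [Function.update_self]
    simp only [h', sum_const, card_univ, smul_eq_mul] at h
    rw [Nat.mul_comm] at h
    rw [h, Nat.mul_comm]
  have hsub : (univ.filter fun X : Fin m → Fin n → Bool => ¬ X ∈ goodT (m := m) e) ⊆
      (univ : Finset (Fin m)).biUnion fun t => univ.filter fun X : Fin m → Fin n → Bool => fireCount3 e (X t) ≠ 1 := by
    intro X hX
    rw [mem_filter, goodT, mem_filter] at hX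
    rw [mem_biUnion]
    have : ¬ ∀ t, fireCount3 e (X t) = 1 := fun h => hX.2 ⟨mem_univ _, h⟩
    obtain ⟨t, ht⟩ := not_forall.mp this
    exact ⟨t, mem_univ _, mem_filter.2 ⟨mem_univ _, ht⟩⟩
  calc (univ.filter fun X : Fin m → Fin n → Bool => ¬ X ∈ goodT (m := m) e).card * Fintype.card (Fin n → Bool)
      ≤ ((univ : Finset (Fin m)).biUnion fun t =>
          univ.filter fun X : Fin m → Fin n → Bool => fireCount3 e (X t) ≠ 1).card * Fintype.card (Fin n → Bool) :=
        Nat.mul_le_mul_right _ (card_le_card hsub)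
    _ ≤ (∑ t : Fin m, (univ.filter fun X : Fin m → Fin n → Bool => fireCount3 e (X t) ≠ 1).card) *
          Fintype.card (Fin n → Bool) := Nat.mul_le_mul_right _ card_biUnion_le
    _ = ∑ t : Fin m, (univ.filter fun x : Fin n → Bool => fireCount3 e x ≠ 1).card *
          Fintype.card (Fin m → Fin n → Bool) := by rw [sum_mul]; exact sum_congr rfl fun t _ => hone t
    _ = _ := by rw [sum_const, card_univ, Fintype.card_fin, smul_eq_mul]

end Counting

/-! ### §8.4 the law -/

section Law

/-- OrbitAveraging helper `deg_bound` (decomp-qadv land package; see the module docstring). -/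
theorem deg_bound (L c : ℕ) (hL : 2 ≤ L) : L ^ 4 + L ^ c * ((L ^ 4 + 1) + (L ^ 4 + 1)) ≤ L ^ (c + 7) := by
  have h1 : 1 ≤ L ^ 4 := Nat.one_le_pow _ _ (by omega)
  have h4 : L ^ 4 ≤ L ^ (c + 4) := Nat.pow_le_pow_right (by omega) (by omega)
  have h8 : 8 ≤ L ^ 3 := by
    calc 8 = 2 ^ 3 := by norm_num
      _ ≤ L ^ 3 := Nat.pow_le_pow_left hL 3
  calc L ^ 4 + L ^ c * ((L ^ 4 + 1) + (L ^ 4 + 1)) ≤ L ^ (c + 4) + L ^ c * (4 * L ^ 4) := by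
        have : (L ^ 4 + 1) + (L ^ 4 + 1) ≤ 4 * L ^ 4 := by omega
        exact Nat.add_le_add h4 (Nat.mul_le_mul_left _ this)
    _ = 5 * L ^ (c + 4) := by rw [pow_add]; ring
    _ ≤ L ^ 3 * L ^ (c + 4) := Nat.mul_le_mul_right _ (by omega)
    _ = L ^ (c + 7) := by rw [← pow_add]; congr 1; omega

/-- OrbitAveraging helper `card_tuples` (decomp-qadv land package; see the module docstring). -/
theorem card_tuples (m n : ℕ) : Fintype.card (Fin m → Fin n → Bool) = 2 ^ (m * n) := by
  simp only [Fintype.card_fun, Fintype.card_bool, Fintype.card_fin]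
  rw [← pow_mul, Nat.mul_comm]

set_option maxHeartbeats 400000 in
/-- **THE EQUIVARIANT NORMAL FORM LAW** (node: `eqvNormalForm3 : EqvNormalForm3`). Many-ring hardness for ring-wise EQUIVARIANT joint strategies
(each ring covariant in its own input, invariant under rotating any other ring) implies many-ring hardness for
ALL joint strategies, at the cost `θ ↦ (1+θ)/2`, `c ↦ c+7` and a larger `n₀`: ring-wise `𝔽₃` leader election
(`exists_election3`, failure `≤ 2ⁿ/n^{K+2}` per ring), the invariant canonical coordinates `q² ∈ {0,1}`
(`canon_ind_mem`, `qc_update_rot`), the symmetrised strategy `psym` (`psym_equivariant`, `psym_mem`), win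
transport on all-good tuples (`win_transport`) and phase averaging (`exists_phase`). [law, PROVED] -/
theorem multiRingHard3_of_equivariant (h : (∃ K : ℕ, ∃ θ : ℝ, θ < 1 ∧ ∀ c : ℕ, ∃ n₀ : ℕ, ∀ n ≥ n₀,
      ∀ P : Fin (n ^ K) → Fin n → CubeFn (ZMod 3) (n ^ K * n),
        ((∀ (X : Fin (n ^ K) → Fin n → Bool) (j : Fin (n ^ K)) (y : Fin n → Bool) (r : ℕ) (i : Fin n),
            decide (P j i (flat (Function.update X j (rot r y))) = 1) =
              decide (P j (RingSymmetry.shift n r i) (flat (Function.update X j y)) = 1)) ∧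
          (∀ (X : Fin (n ^ K) → Fin n → Bool) (j s : Fin (n ^ K)), s ≠ j → ∀ (y : Fin n → Bool) (i : Fin n),
            decide (P s i (flat (Function.update X j (rot 1 y))) = 1) =
              decide (P s i (flat (Function.update X j y)) = 1))) →
        (∀ j i, P j i ∈ lowDeg (ZMod 3) (n ^ K * n) ((Nat.log 2 n) ^ c)) →
        ((univ.filter fun X : Fin (n ^ K) → Fin n → Bool => ∀ j, RingHLF.Rel (X j)
          (fun i => decide (P j i (fun k => X (finProdFinEquiv.symm k).1 (finProdFinEquiv.symm k).2) = 1))).card : ℝ)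
          ≤ θ * (2 : ℝ) ^ (n ^ K * n))) :
    Theses.SpreadDial.MultiRingHard3 := by
  obtain ⟨K, θ, hθ, hH⟩ := h
  refine ⟨K, (1 + θ) / 2, by linarith, fun c => ?_⟩
  obtain ⟨n₀, hn₀⟩ := hH (c + 7)
  refine ⟨max n₀ (max (2 ^ (2 * K + 11)) (⌈2 / (1 - θ)⌉₊ + 2)), fun n hn P hP => ?_⟩
  have hn0 : n₀ ≤ n := le_trans (le_max_left _ _) hn
  have h11 : 2 ^ (2 * K + 11) ≤ n := le_trans (le_trans (le_max_left _ _) (le_max_right _ _)) hn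
  have hθn : ⌈2 / (1 - θ)⌉₊ + 2 ≤ n := le_trans (le_trans (le_max_right _ _) (le_max_right _ _)) hn
  have hn4 : 4 ≤ n := le_trans (by
      calc (4 : ℕ) = 2 ^ 2 := by norm_num
        _ ≤ 2 ^ (2 * K + 11) := Nat.pow_le_pow_right (by norm_num) (by omega)) h11
  have hnpos : 0 < n := by omega
  have hL : 2 ≤ Nat.log 2 n := Nat.le_log_of_pow_le (by norm_num) (show 2 ^ 2 ≤ n from hn4)
  -- ring-wise leader election
  obtain ⟨h2l, ht, hl, hdeg⟩ := election_params K n h11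
  obtain ⟨e, he, he01, hbad⟩ := exists_election3 hnpos h2l ht hl
  have he' : e ∈ lowDeg (ZMod 3) n ((Nat.log 2 n) ^ 4) := lowDeg_mono hdeg he
  show ((winAllSet P).card : ℝ) ≤ (1 + θ) / 2 * (2 : ℝ) ^ (n ^ K * n)
  -- the symmetrised strategies are equivariant, of degree ≤ L^(c+7), hence θ-bounded
  have hdegP : ∀ (s : Fin (n ^ K) → ℕ) (j : Fin (n ^ K)) (b : Fin n),
      psym e s P j b ∈ lowDeg (ZMod 3) (n ^ K * n) ((Nat.log 2 n) ^ (c + 7)) := fun s j b =>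
    lowDeg_mono (deg_bound _ c hL) (psym_mem he' s hP j b)
  have hwin : ∀ s : Fin (n ^ K) → ℕ,
      ((winAllSet (psym e s P)).card : ℝ) ≤ θ * (2 : ℝ) ^ (n ^ K * n) :=
    fun s => hn₀ n hn0 (psym e s P) (psym_equivariant e s P) (hdegP s)
  -- a phase vector doing at least average
  obtain ⟨s, hs⟩ := exists_phase (m := n ^ K) hnpos e (winAllSet P)
  -- transport on all-good tuples
  have htr : (univ.filter fun X : Fin (n ^ K) → Fin n → Bool =>
        X ∈ goodT (m := n ^ K) e ∧ zT hnpos e (fun t => (s t).val) X ∈ winAllSet P) ⊆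
      winAllSet (psym e (fun t => (s t).val) P) := by
    intro X hX
    rw [mem_filter] at hX
    have hG : ∀ t, fireCount3 e (X t) = 1 := by
      have h := hX.2.1
      rw [goodT, mem_filter] at h
      exact h.2
    have hZ := hX.2.2
    rw [winAllSet, mem_filter] at hZ ⊢
    exact ⟨mem_univ _, fun j => (win_transport hnpos he01 (fun t => (s t).val) P hG j).2 (hZ.2 j)⟩
  -- split the win set by goodness
  have hsplit : (winAllSet P).card ≤
      (univ.filter fun X : Fin (n ^ K) → Fin n → Bool => X ∈ goodT (m := n ^ K) e ∧ X ∈ winAllSet P).card +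
        (univ.filter fun X : Fin (n ^ K) → Fin n → Bool => ¬ X ∈ goodT (m := n ^ K) e).card := by
    calc (winAllSet P).card
        ≤ ((univ.filter fun X : Fin (n ^ K) → Fin n → Bool => X ∈ goodT (m := n ^ K) e ∧ X ∈ winAllSet P) ∪
            (univ.filter fun X : Fin (n ^ K) → Fin n → Bool => ¬ X ∈ goodT (m := n ^ K) e)).card := by
          refine card_le_card fun X hX => ?_
          rw [mem_union, mem_filter, mem_filter]
          by_cases hG : X ∈ goodT (m := n ^ K) e
          · exact Or.inl ⟨mem_univ _, hG, hX⟩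
          · exact Or.inr ⟨mem_univ _, hG⟩
      _ ≤ _ := card_union_le _ _
  -- the good part
  have hGW : ((univ.filter fun X : Fin (n ^ K) → Fin n → Bool =>
      X ∈ goodT (m := n ^ K) e ∧ X ∈ winAllSet P).card : ℝ) ≤ θ * (2 : ℝ) ^ (n ^ K * n) := by
    calc ((univ.filter fun X : Fin (n ^ K) → Fin n → Bool =>
          X ∈ goodT (m := n ^ K) e ∧ X ∈ winAllSet P).card : ℝ)
        ≤ (univ.filter fun X : Fin (n ^ K) → Fin n → Bool =>
            X ∈ goodT (m := n ^ K) e ∧ zT hnpos e (fun t => (s t).val) X ∈ winAllSet P).card := by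
          exact_mod_cast hs
      _ ≤ (winAllSet (psym e (fun t => (s t).val) P)).card := by exact_mod_cast card_le_card htr
      _ ≤ _ := hwin _
  -- the bad part: `#(¬good) · n² ≤ 2^(n^K·n)`
  have hNG : ((univ.filter fun X : Fin (n ^ K) → Fin n → Bool => ¬ X ∈ goodT (m := n ^ K) e).card : ℝ) *
      (n : ℝ) ^ 2 ≤ (2 : ℝ) ^ (n ^ K * n) := by
    have h1 := card_not_goodT_le (m := n ^ K) e
    rw [card_tuples] at h1
    simp only [Fintype.card_fun, Fintype.card_bool, Fintype.card_fin] at h1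
    have h1R : ((univ.filter fun X : Fin (n ^ K) → Fin n → Bool => ¬ X ∈ goodT (m := n ^ K) e).card : ℝ) *
        (2 : ℝ) ^ n ≤ (n : ℝ) ^ K * (((univ.filter fun x : Fin n → Bool => fireCount3 e x ≠ 1).card : ℝ) *
          (2 : ℝ) ^ (n ^ K * n)) := by exact_mod_cast h1
    have hbadR : (((univ.filter fun x : Fin n → Bool => fireCount3 e x ≠ 1).card : ℝ)) *
        ((n : ℝ) * (n : ℝ) ^ (K + 1)) ≤ (2 : ℝ) ^ n := by exact_mod_cast hbad
    have hq : (0 : ℝ) < (2 : ℝ) ^ n := by positivity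
    have hK : (0 : ℝ) < (n : ℝ) ^ K := by positivity
    set A : ℝ := ((univ.filter fun X : Fin (n ^ K) → Fin n → Bool => ¬ X ∈ goodT (m := n ^ K) e).card : ℝ)
    set B : ℝ := (((univ.filter fun x : Fin n → Bool => fireCount3 e x ≠ 1).card : ℝ))
    have hA : 0 ≤ A := by positivity
    have step1 : A * (2 : ℝ) ^ n * ((n : ℝ) * (n : ℝ) ^ (K + 1)) ≤ (n : ℝ) ^ K * (2 : ℝ) ^ (n ^ K * n) * (2 : ℝ) ^ n := by
      calc A * (2 : ℝ) ^ n * ((n : ℝ) * (n : ℝ) ^ (K + 1))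
          ≤ (n : ℝ) ^ K * (B * (2 : ℝ) ^ (n ^ K * n)) * ((n : ℝ) * (n : ℝ) ^ (K + 1)) :=
            mul_le_mul_of_nonneg_right h1R (by positivity)
        _ = (n : ℝ) ^ K * (2 : ℝ) ^ (n ^ K * n) * (B * ((n : ℝ) * (n : ℝ) ^ (K + 1))) := by ring
        _ ≤ (n : ℝ) ^ K * (2 : ℝ) ^ (n ^ K * n) * (2 : ℝ) ^ n := mul_le_mul_of_nonneg_left hbadR (by positivity)
    have step2 : A * ((n : ℝ) * (n : ℝ) ^ (K + 1)) ≤ (n : ℝ) ^ K * (2 : ℝ) ^ (n ^ K * n) := by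
      rw [show A * (2 : ℝ) ^ n * ((n : ℝ) * (n : ℝ) ^ (K + 1)) =
        A * ((n : ℝ) * (n : ℝ) ^ (K + 1)) * (2 : ℝ) ^ n by ring] at step1
      exact le_of_mul_le_mul_right step1 hq
    have step3 : A * (n : ℝ) ^ 2 * (n : ℝ) ^ K ≤ (2 : ℝ) ^ (n ^ K * n) * (n : ℝ) ^ K := by
      calc A * (n : ℝ) ^ 2 * (n : ℝ) ^ K = A * ((n : ℝ) * (n : ℝ) ^ (K + 1)) := by ring
        _ ≤ (n : ℝ) ^ K * (2 : ℝ) ^ (n ^ K * n) := step2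
        _ = (2 : ℝ) ^ (n ^ K * n) * (n : ℝ) ^ K := by ring
    exact le_of_mul_le_mul_right step3 hK
  have h1θ : 0 < 1 - θ := by linarith
  have hn2 : (2 : ℝ) / (1 - θ) ≤ (n : ℝ) ^ 2 := by
    have hc : (2 : ℝ) / (1 - θ) ≤ ⌈2 / (1 - θ)⌉₊ := Nat.le_ceil _
    have hnR : (⌈2 / (1 - θ)⌉₊ : ℝ) + 2 ≤ n := by exact_mod_cast hθn
    have hsq : (n : ℝ) ≤ (n : ℝ) ^ 2 := by exact_mod_cast Nat.le_self_pow two_ne_zero n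
    linarith
  have hbadR : ((univ.filter fun X : Fin (n ^ K) → Fin n → Bool => ¬ X ∈ goodT (m := n ^ K) e).card : ℝ) ≤
      (1 - θ) / 2 * (2 : ℝ) ^ (n ^ K * n) := by
    have hn2pos : (0 : ℝ) < (n : ℝ) ^ 2 := by positivity
    have hne : (1 - θ) ≠ 0 := ne_of_gt h1θ
    have hdiv : ((univ.filter fun X : Fin (n ^ K) → Fin n → Bool => ¬ X ∈ goodT (m := n ^ K) e).card : ℝ) ≤
        (2 : ℝ) ^ (n ^ K * n) / (n : ℝ) ^ 2 := by
      rw [le_div_iff₀ hn2pos]; exact hNG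
    calc ((univ.filter fun X : Fin (n ^ K) → Fin n → Bool => ¬ X ∈ goodT (m := n ^ K) e).card : ℝ)
        ≤ (2 : ℝ) ^ (n ^ K * n) / (n : ℝ) ^ 2 := hdiv
      _ ≤ (2 : ℝ) ^ (n ^ K * n) / (2 / (1 - θ)) :=
          div_le_div_of_nonneg_left (by positivity) (div_pos two_pos h1θ) hn2
      _ = (1 - θ) / 2 * (2 : ℝ) ^ (n ^ K * n) := by field_simp
  calc ((winAllSet P).card : ℝ)
      ≤ ((univ.filter fun X : Fin (n ^ K) → Fin n → Bool => X ∈ goodT (m := n ^ K) e ∧ X ∈ winAllSet P).card : ℝ) +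
          ((univ.filter fun X : Fin (n ^ K) → Fin n → Bool => ¬ X ∈ goodT (m := n ^ K) e).card : ℝ) := by
        exact_mod_cast hsplit
    _ ≤ θ * (2 : ℝ) ^ (n ^ K * n) + (1 - θ) / 2 * (2 : ℝ) ^ (n ^ K * n) := add_le_add hGW hbadR
    _ = (1 + θ) / 2 * (2 : ℝ) ^ (n ^ K * n) := by ring

end Law

end NormalFormLaw

/-- the converse (restriction to equivariant adversaries) — so the many-ring target is EQUIVALENT to its equivariant
normal form. -/
theorem multiRingHard3_iff_equivariant : Theses.SpreadDial.MultiRingHard3 ↔ (∃ K : ℕ, ∃ θ : ℝ, θ < 1 ∧ ∀ c : ℕ, ∃ n₀ : ℕ, ∀ n ≥ n₀,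
      ∀ P : Fin (n ^ K) → Fin n → CubeFn (ZMod 3) (n ^ K * n),
        ((∀ (X : Fin (n ^ K) → Fin n → Bool) (j : Fin (n ^ K)) (y : Fin n → Bool) (r : ℕ) (i : Fin n),
            decide (P j i (flat (Function.update X j (rot r y))) = 1) =
              decide (P j (RingSymmetry.shift n r i) (flat (Function.update X j y)) = 1)) ∧
          (∀ (X : Fin (n ^ K) → Fin n → Bool) (j s : Fin (n ^ K)), s ≠ j → ∀ (y : Fin n → Bool) (i : Fin n),
            decide (P s i (flat (Function.update X j (rot 1 y))) = 1) =
              decide (P s i (flat (Function.update X j y)) = 1))) →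
        (∀ j i, P j i ∈ lowDeg (ZMod 3) (n ^ K * n) ((Nat.log 2 n) ^ c)) →
        ((univ.filter fun X : Fin (n ^ K) → Fin n → Bool => ∀ j, RingHLF.Rel (X j)
          (fun i => decide (P j i (fun k => X (finProdFinEquiv.symm k).1 (finProdFinEquiv.symm k).2) = 1))).card : ℝ)
          ≤ θ * (2 : ℝ) ^ (n ^ K * n)) :=
  ⟨multiRingHardEqv3_of_multiRingHard3, multiRingHard3_of_equivariant⟩

/-! ## §9 closes -/

/-- the R-side statement ALONE (invariant-foreign spread for uniform victims, node `InvSpreadLoss3`) gives the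
many-ring target: hybrid lemma in the equivariant class, then the equivariant normal form law. -/
theorem multiRingHard3_of_invSpread (hI : (∃ η : ℝ, 0 < η ∧ ∃ k : ℕ, ∀ c : ℕ, ∃ n₀ : ℕ, ∀ n ≥ n₀, ∀ Q : CubeFn (ZMod 3) n,
  Q ∈ lowDeg (ZMod 3) n ((Nat.log 2 n) ^ c) →
  ∀ m : ℕ, m ≤ n ^ k → ∀ w : Fin m → Fin n → Bool, ∀ F : Fin m → Fin n → CubeFn (ZMod 3) n,
    (∀ t i, F t i ∈ lowDeg (ZMod 3) n ((Nat.log 2 n) ^ c)) →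
    (∀ t i y, decide (F t i (rot 1 y) = 1) = decide (F t i y = 1)) →
    (1 - η) * (2 : ℝ) ^ n ≤ ((univ.filter fun y : Fin n → Bool =>
        ∀ t, RingHLF.Rel (w t) (fun i => decide (F t i y = 1))).card : ℝ) →
    1 / (n : ℝ) ^ k * (2 : ℝ) ^ n ≤ ((univ.filter fun y : Fin n → Bool =>
        (∀ t, RingHLF.Rel (w t) (fun i => decide (F t i y = 1))) ∧ ¬ RingHLF.Rel y (cov Q y)).card : ℝ))) :
    Theses.SpreadDial.MultiRingHard3 :=
  multiRingHard3_of_equivariant (hybridEqv3 hI)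

/-- **closes** (node `OrbitDial.closes`, two binders, both load-bearing): the junction 26123 and the relocated
residual R (node `InvCoverLift3`, spelled out) give the leaf BY NAME — through the PROVED `hybridEqv3`, the PROVED
normal form law `multiRingHard3_of_equivariant` and the landed `adviceFreeQNC0Three_of_multiRingHard3`
(`SpreadDial.MultiRingHard3` and `ProductDial.MultiRingHard3` are the same term). -/
theorem adviceFreeQNC0Three_of_orbitDial (hP : Theses.SpreadDial.PolyLoss3) (hR : (Theses.SpreadDial.PolyLoss3 →
    (∃ η : ℝ, 0 < η ∧ ∃ k : ℕ, ∀ c : ℕ, ∃ n₀ : ℕ, ∀ n ≥ n₀, ∀ Q : CubeFn (ZMod 3) n,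
  Q ∈ lowDeg (ZMod 3) n ((Nat.log 2 n) ^ c) →
  ∀ m : ℕ, m ≤ n ^ k → ∀ w : Fin m → Fin n → Bool, ∀ F : Fin m → Fin n → CubeFn (ZMod 3) n,
    (∀ t i, F t i ∈ lowDeg (ZMod 3) n ((Nat.log 2 n) ^ c)) →
    (∀ t i y, decide (F t i (rot 1 y) = 1) = decide (F t i y = 1)) →
    (1 - η) * (2 : ℝ) ^ n ≤ ((univ.filter fun y : Fin n → Bool =>
        ∀ t, RingHLF.Rel (w t) (fun i => decide (F t i y = 1))).card : ℝ) →
    1 / (n : ℝ) ^ k * (2 : ℝ) ^ n ≤ ((univ.filter fun y : Fin n → Bool =>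
        (∀ t, RingHLF.Rel (w t) (fun i => decide (F t i y = 1))) ∧ ¬ RingHLF.Rel y (cov Q y)).card : ℝ)))) :
    Summit.QuantumAdvantage.AdviceFreeQNC0.AdviceFreeQNC0Three :=
  Theorems.adviceFreeQNC0Three_of_multiRingHard3 (multiRingHard3_of_invSpread (hR hP))

/-- `closes` without the junction: invariant-foreign spread for uniform victims gives the leaf. -/
theorem adviceFreeQNC0Three_of_invSpread (hI : (∃ η : ℝ, 0 < η ∧ ∃ k : ℕ, ∀ c : ℕ, ∃ n₀ : ℕ, ∀ n ≥ n₀, ∀ Q : CubeFn (ZMod 3) n,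
  Q ∈ lowDeg (ZMod 3) n ((Nat.log 2 n) ^ c) →
  ∀ m : ℕ, m ≤ n ^ k → ∀ w : Fin m → Fin n → Bool, ∀ F : Fin m → Fin n → CubeFn (ZMod 3) n,
    (∀ t i, F t i ∈ lowDeg (ZMod 3) n ((Nat.log 2 n) ^ c)) →
    (∀ t i y, decide (F t i (rot 1 y) = 1) = decide (F t i y = 1)) →
    (1 - η) * (2 : ℝ) ^ n ≤ ((univ.filter fun y : Fin n → Bool =>
        ∀ t, RingHLF.Rel (w t) (fun i => decide (F t i y = 1))).card : ℝ) →
    1 / (n : ℝ) ^ k * (2 : ℝ) ^ n ≤ ((univ.filter fun y : Fin n → Bool =>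
        (∀ t, RingHLF.Rel (w t) (fun i => decide (F t i y = 1))) ∧ ¬ RingHLF.Rel y (cov Q y)).card : ℝ))) :
    Summit.QuantumAdvantage.AdviceFreeQNC0.AdviceFreeQNC0Three :=
  Theorems.adviceFreeQNC0Three_of_multiRingHard3 (multiRingHard3_of_invSpread hI)

end Summit.QuantumAdvantage.QuantumAdvantage.Theorems.OrbitAveraging

end
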